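import Summits.QuantumFields.YangMills.Theorems.BalabanUVNodesN11CondLawInFibreChartSkewAssembly
import Literature.MathematicalPhysics.QuantumFieldTheory.Balaban1983to89.Node00.AveragingSkewPresentation
import Summits.QuantumFields.YangMills.Theorems.BalabanUVNodesN11TStepInFibreChart

/-!
# DAG node N11 — THE KERNEL-LEVEL SOCKET AT THE RECORD: naturality under measurable equivalences of both carriers; the fibre chart of the joint law of `(Ū, U)` for
# `avOfRecord F N K j` at `(fieldMeasure j, fieldMeasure (j+1))` FROM FIBREWISE INSIDE CHARTS IN THE GLUE COORDINATES; the separated transport and def-T's (†) for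
# all `s′`, every density at once, outer factor = 11a's `kernelRTOfRecord`

HEADER — WORK-UNIT METADATA.  Cell `pub-ymgap`, YM-PLAN Track A (D-0062), seat `pub-ymgap-dag-n08-w2` (g8; WIDTH SEAT 2∕4 on N08 [B10], RE-POINTED to N11's [III] §3-supply
residue), route `BalabanUVNodes` rev 27, key K1⁷ `StabilityBAtRecordR13SepCoPH` = stmt-QuantumFields-20542 (helper lane `--supports 20542 --as helper`, count-neutral; K1⁷ `aside`
behind K1⁸ 26907 — (B4)-socket bookkeeping).  [I] = [Balaban1987RG1], [III] = [Balaban1988Convergent].  FILE 6 of this seat's kernel-level socket (FILE 1 p611747 · FILE 2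
p618553 · FILE 3 p615387 · FILE 4 p616825 · FILE 5 `…SkewAssembly` p621159 · FILE 7 `…TStepInPrivateCoordinateChart`).  Over dag-n11-e g21's `Node00/AveragingSkewPresentation`
(p612977 ✓: `fieldMeasure_eq_map_piEquivPiSubtypeProd_symm` — both carriers are glued products —, `avOfRecord_glue_eq_glue` — the skew intertwining, out-factor = 11a's
`avgRestrOfRecord` LITERALLY —, `measurable_avOfRecord_glue_rest`, `map_pi_avgRestrOfRecord_absolutelyContinuous` = the displayed `hac_out`), 11a's `Node00.TkOfRecord`
(`avgRestrOfRecord`, `kernelRTOfRecord`), def-T's `transportOfRecord` ∕ `tstepOfRecord`, `avOfRecord_measurable`, `avOfRecord_haarAC`.  Companions (per-density, fixed inner charted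
set; CITED): dag-n11-w2 g3's `…KernelTransportRecoordinatisation` (p612351) ∕ `…TransportOfRecordSeparated` (p614048), dag-n11-d g14's `…TStepOfRecordSeparated` (p616225).

WHY.  FILE 5 assembles [III] §3's separated presentation in GENERIC product coordinates; at the record the carriers are `GaugeField = (PBond → SU N)`, presented by Mathlib's
`piEquivPiSubtypeProd` glue at the bond partition `sV ∕ sVᶜ`, `sV' ∕ sV'ᶜ` of a fine region saturated at level `j+1` (11a's `genDataOfRecord` choice `sV = bondsIn j (Ω_{j+1})ᶜ`,
`sV' = bondsIn (j+1) (Ω_{j+1})ᶜ`).  §1 proves FILE 1's `hchart` NATURAL under measurable equivalences of both carriers intertwining the averagings; §2 instantiates: from FIBREWISE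
INSIDE CHARTS IN THE GLUE COORDINATES (FILE 4's `hfib`, `(Π_{sV} Haar)`-a.e. outside datum — what a chart seat delivers, e.g. dag-n11-w6's private-coordinate chart of the RESTRICTED
averaging) and `hac_out` ALONE, `hchart` holds for `(avOfRecord F N K j).avg` at `(fieldMeasure j, fieldMeasure (j+1))`, so FILES 1–2 apply AT THE RECORD with this chart; §3 spells
the separated one-step transport out — `transportOfRecord F N K j ρ V′ = kernelRTOfRecord F N K j sV sV' (u₁ ↦ ∫ κ_in((u₁,r),dx) J_in·ρ(e_β(u₁, Ψ_in((u₁,r),x)))) o`, `(o, r) = e_α⁻¹V′`,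
for a.e. `V′` and EVERY measurable `ρ` vanishing off the window (outside variables by 11a's TRUE restricted transport, inside variables charted; null set uniform in `ρ`) —, and §4
the same for def-T's (†) `tstepOfRecord … s′ V′`, ALL new sequences `s′` at once (its `V′`-dependent step weights are why the uniform null set matters).

CONTENTS (0 `def`, 0 `sorry`): §1 ★★ `chart_of_equiv_presentation` · §2 ★★★ `chart_avOfRecord_of_fibrewise_glue`, `measurableSet_glueWindow`, ★★ `ae_forall_integral_compositeKernel_eq_glue`
· §3 ★★★ `ae_forall_transportOfRecord_eq_kernelRTOfRecord_glue` · §4 ★★★ `ae_forall_tstepOfRecord_eq_kernelRTOfRecord_glue`.  HONEST FRAMING.  Helper lane of K1⁷ (aside); count-neutral; pure measure theory (`lintegral_map_equiv`, `Measure.ext_of_lintegral`, `MeasurableEmbedding.ae_map_iff`) and by-name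
compositions; NO chart of Bałaban's constructed, NO Jacobian computed — the fibrewise inside identity `hfib` stays the HYPOTHESIS a Lie–Haar ∕ chart seat discharges; `hY`, `hsV`∕`hsV'`,
`hac_out`, `j < K`, the step weights' support clause and the fibre integrability are DISPLAYED; nothing of Bałaban ([I] §2, [III] §3 (3.10)–(3.25)) asserted; (B4)∕(S-α)∕(O3′) NOT
closed; N11 NOT discharged; N08 untouched; K1⁷∕K1⁸ NOT closed, no registered stub touched; counts unmoved (typed 28∕28 · discharged 5∕27 · A 5∕28).  One finite `𝕋⁴_{L^K}`
programme at fixed `ε = L^{−K}`; R4 closes only the conditional finite-𝕋⁴ rung `BalabanLadder.UV` — NOT ℝ⁴, NOT OS, NOT a mass gap, NOT Clay.  No `sorry`, `axiom`, `def`,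
`instance`, `notation`.  Sources (SHAPE only): [I] (0.4) p.253, Sect. 2 pp.260–262; [III] (2.21) p.258, (3.1) p.264, (3.2)–(3.5) p.265, (3.10)–(3.11) p.266, p.267 L18–24, p.270 L3–6.
-/

noncomputable section

open MeasureTheory ProbabilityTheory
open scoped ENNReal NNReal

namespace Summit.QuantumFields.YangMills.Theorems.BalabanUVNodesN11CondLawInFibreChartAtRecord

open Literature.MathematicalPhysics.QuantumFieldTheory.Balaban1983to89
open Literature.MathematicalPhysics.QuantumFieldTheory.Balaban1983to89.T4AveragingDisintegration
open BalabanUVNodesN11CondLawInFibreChart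

/-! ## §1  The kernel-level socket is NATURAL under measurable equivalences of BOTH carriers intertwining the averagings -/

section Transport

variable {α β α' β' X : Type*} [MeasurableSpace α] [MeasurableSpace β] [MeasurableSpace α'] [MeasurableSpace β'] [MeasurableSpace X]
variable {ν' : Measure β'} {μ' : Measure α'} [SFinite μ'] {κ' : Kernel α' X} [IsSFiniteKernel κ']
variable {avg : β → α} {avg' : β' → α'} {Ψ' : α' × X → β'} {J' : α' × X → ℝ≥0} {𝒮' : Set (α' × β')}

/-- **★★ THE KERNEL-LEVEL SOCKET IS NATURAL UNDER PRESENTATIONS OF BOTH CARRIERS BY MEASURABLE EQUIVALENCES**: if `e_α : α' ≃ᵐ α`, `e_β : β' ≃ᵐ β`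
intertwine the averagings (`avg (e_β U') = e_α (avg' U')`) and `(κ', Ψ', J', 𝒮')` is a fibre chart of the joint law of `(avg' U', U')` under `ν'` on the window
`𝒮'` with respect to `μ'` (FILE 1's `hchart` ON THE COORDINATE SIDE), then the transported data — fibre kernel `κ'.comap e_α⁻¹`, chart `(V, x) ↦ e_β (Ψ' (e_α⁻¹ V, x))`,
Jacobian `(V, x) ↦ J' (e_α⁻¹ V, x)`, window `{(V, U) | (e_α⁻¹ V, e_β⁻¹ U) ∈ 𝒮'}` — is a fibre chart of the joint law of `(avg U, U)` under `ν'.map e_β` with respect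
to `μ'.map e_α` (FILE 1's `hchart` AT THE PRESENTED CARRIERS).  Both sides integrate every measurable `G ≥ 0` to `∫ G(e_α y, e_β U') d((jointLaw ν' avg')|_{𝒮'})`.
[cite: Balaban1987RG1, (0.4) p.253; Balaban1988Convergent, (2.21) p.258, (3.1) p.264 (bookkeeping: re-coordinatisation of both carriers)] -/
theorem chart_of_equiv_presentation (eα : α' ≃ᵐ α) (eβ : β' ≃ᵐ β) (havg : Measurable avg) (havg' : Measurable avg')
    (hint : ∀ U', avg (eβ U') = eα (avg' U')) (hΨ' : Measurable Ψ') (hJ' : Measurable J') (h𝒮' : MeasurableSet 𝒮')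
    (hchart' : ((μ' ⊗ₘ κ').withDensity (fun z => (J' z : ℝ≥0∞))).map (fun z => (z.1, Ψ' z)) = (jointLaw ν' avg').restrict 𝒮') :
    (((μ'.map eα) ⊗ₘ (κ'.comap eα.symm eα.symm.measurable)).withDensity (fun z => (J' (eα.symm z.1, z.2) : ℝ≥0∞))).map
        (fun z => (z.1, eβ (Ψ' (eα.symm z.1, z.2)))) =
      (jointLaw (ν'.map eβ) avg).restrict {w : α × β | (eα.symm w.1, eβ.symm w.2) ∈ 𝒮'} := by
  have h𝒮 : MeasurableSet {w : α × β | (eα.symm w.1, eβ.symm w.2) ∈ 𝒮'} :=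
    (show Measurable (fun w : α × β => (eα.symm w.1, eβ.symm w.2)) by fun_prop) h𝒮'
  refine Measure.ext_of_lintegral _ fun G hG => ?_
  -- the coordinate-side integrand
  set G' : α' × β' → ℝ≥0∞ := fun w => G (eα w.1, eβ w.2) with hG'def
  have hG' : Measurable G' := hG.comp ((eα.measurable.comp measurable_fst).prodMk (eβ.measurable.comp measurable_snd))
  -- left side: unfold to the iterated chart integral on the coordinate side, = ∫ G' d(coordinate chart measure)
  have hφ : Measurable fun z : α × X => (z.1, eβ (Ψ' (eα.symm z.1, z.2))) := by fun_prop
  have hJ : Measurable fun z : α × X => (J' (eα.symm z.1, z.2) : ℝ≥0∞) := by fun_prop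
  have hL : ∫⁻ w, G w ∂((((μ'.map eα) ⊗ₘ (κ'.comap eα.symm eα.symm.measurable)).withDensity
        (fun z => (J' (eα.symm z.1, z.2) : ℝ≥0∞))).map (fun z => (z.1, eβ (Ψ' (eα.symm z.1, z.2))))) =
      ∫⁻ w, G' w ∂(((μ' ⊗ₘ κ').withDensity (fun z => (J' z : ℝ≥0∞))).map (fun z => (z.1, Ψ' z))) := by
    rw [lintegral_map hG hφ,
      lintegral_withDensity_eq_lintegral_mul _ hJ (show Measurable (fun z : α × X => G (z.1, eβ (Ψ' (eα.symm z.1, z.2)))) from hG.comp hφ)]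
    change ∫⁻ z, (J' (eα.symm z.1, z.2) : ℝ≥0∞) * G (z.1, eβ (Ψ' (eα.symm z.1, z.2))) ∂((μ'.map eα) ⊗ₘ _) = _
    rw [Measure.lintegral_compProd (show Measurable (fun z : α × X => (J' (eα.symm z.1, z.2) : ℝ≥0∞) * G (z.1, eβ (Ψ' (eα.symm z.1, z.2)))) by
        fun_prop),
      lintegral_map_equiv _ eα, lintegral_map hG' (measurable_fst.prodMk hΨ'),
      lintegral_withDensity_eq_lintegral_mul _ hJ'.coe_nnreal_ennreal
        (show Measurable (fun z : α' × X => G' (z.1, Ψ' z)) from hG'.comp (measurable_fst.prodMk hΨ'))]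
    change _ = ∫⁻ z, (J' z : ℝ≥0∞) * G' (z.1, Ψ' z) ∂(μ' ⊗ₘ κ')
    rw [Measure.lintegral_compProd (show Measurable (fun z : α' × X => (J' z : ℝ≥0∞) * G' (z.1, Ψ' z)) by fun_prop)]
    refine lintegral_congr fun y => ?_
    simp only [Kernel.comap_apply, MeasurableEquiv.symm_apply_apply, hG'def]
  -- right side: the joint law of the presented fine carrier cut down to the window, read on the coordinate side
  have hR : ∫⁻ w, G w ∂((jointLaw (ν'.map eβ) avg).restrict {w : α × β | (eα.symm w.1, eβ.symm w.2) ∈ 𝒮'}) =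
      ∫⁻ w, G' w ∂((jointLaw ν' avg').restrict 𝒮') := by
    rw [← lintegral_indicator h𝒮, jointLaw, lintegral_map (hG.indicator h𝒮) (measurable_graphMap havg), lintegral_map_equiv _ eβ,
      ← lintegral_indicator h𝒮', jointLaw, lintegral_map (hG'.indicator h𝒮') (measurable_graphMap havg')]
    refine lintegral_congr fun U' => ?_
    rw [hint U']
    by_cases hU : (avg' U', U') ∈ 𝒮'
    · rw [Set.indicator_of_mem hU, Set.indicator_of_mem (show (eα (avg' U'), eβ U') ∈ {w : α × β | (eα.symm w.1, eβ.symm w.2) ∈ 𝒮'} by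
        simpa only [Set.mem_setOf_eq, MeasurableEquiv.symm_apply_apply] using hU)]
    · rw [Set.indicator_of_notMem hU, Set.indicator_of_notMem (show (eα (avg' U'), eβ U') ∉ {w : α × β | (eα.symm w.1, eβ.symm w.2) ∈ 𝒮'} by
        simpa only [Set.mem_setOf_eq, MeasurableEquiv.symm_apply_apply] using hU)]
  rw [hL, hchart', hR]

end Transport

/-! ## §2  AT THE RECORD: the kernel-level socket for `avOfRecord F N K j` at `(fieldMeasure j, fieldMeasure (j+1))` from FIBREWISE INSIDE CHARTS IN THE GLUE COORDINATES
of the bond partition `sV ∕ sVᶜ`, `sV' ∕ sV'ᶜ` of a saturated region (n11-e's presentations + FILE 5 ★★★ + §1) -/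

section Record

open Node00 hiding SU
open T4Continuum
open B10Eq42TorusConstraint (bondsIn)
open B10Eq38TorusDomains (toFine)
open BalabanUVNodesN11CondLawInFibreChartSkewAssembly

variable {F : T4Family} {N : ℕ} [NeZero N]

/-- **★★★ THE KERNEL-LEVEL SOCKET FOR THE AVERAGING OF RECORD, FROM FIBREWISE INSIDE CHARTS IN THE GLUE COORDINATES OF RECORD.**  For `Y` saturated at level `j+1` (`hY`),
`sV ⊇ bondsIn j Y`, `sV' ⊆ bondsIn (j+1) Y`, the glues `e_β`, `e_α` = `piEquivPiSubtypeProd.symm` at `sV`, `sV'`, the out-factor `a₁ := avgRestrOfRecord F N K j sV sV'` with `hac_out`,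
and the rest factor `a_in q := (c ∉ sV') ↦ avg (e_β q) c`: IF inside charts `(κ_in, Ψ_in, J_in, 𝒮_in)` satisfy FILE 4's fibrewise identity `hfib` for `(Π_{sV} Haar)`-a.e. outside
datum, THEN FILE 1's `hchart` holds for `(avOfRecord F N K j).avg` at `(fieldMeasure j, fieldMeasure (j+1))` with fibre kernel = FILE 5's composite kernel read through `e_α⁻¹`,
chart `(V, (w, x)) ↦ e_β (w.1, Ψ_in (w, x))`, Jacobian `J_in`, window `{(V, U) | ((e_β⁻¹U).1, ((c ∉ sV') ↦ Ū c, (e_β⁻¹U).2)) ∈ 𝒮_in}` — FILE 5 ★★★ `chart_skew_of_fibrewise`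
transported by §1 along n11-e's `fieldMeasure_eq_map_piEquivPiSubtypeProd_symm` and `avOfRecord_glue_eq_glue`.
[cite: Balaban1987RG1, (0.4) p.253, Sect. 2 pp.260–262; Balaban1988Convergent, (2.21) p.258, (3.1) p.264, (3.2)–(3.5) p.265, (3.10)–(3.11) p.266, p.267 L18–24, p.270 L3–6] -/
theorem chart_avOfRecord_of_fibrewise_glue (K j : ℕ) [DecidableEq (PBond (F.P K) j)] [DecidableEq (PBond (F.P K) (j + 1))]
    (hj : j + 1 ≤ (F.P K).m + (F.P K).K)
    {Y : Set (Site (F.P K) 0)} (hY : ∀ s : Site (F.P K) j, toFine j s ∈ Y ↔ toFine (j + 1) (blockOf s) ∈ Y)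
    {sV : Finset (PBond (F.P K) j)} (hsV : ∀ b : PBond (F.P K) j, b ∈ bondsIn j Y → b ∈ sV)
    {sV' : Finset (PBond (F.P K) (j + 1))} (hsV' : ∀ c : PBond (F.P K) (j + 1), c ∈ sV' → c ∈ bondsIn (j + 1) Y)
    (hac_out : (Measure.pi fun _ : ↥sV => (HaarData.haar : Measure (SU N))).map (avgRestrOfRecord F N K j sV sV') ≪
      Measure.pi fun _ : ↥sV' => (HaarData.haar : Measure (SU N)))
    {X : Type*} [MeasurableSpace X]
    {κin : Kernel ((↥sV → SU N) × ({c : PBond (F.P K) (j + 1) // c ∉ sV'} → SU N)) X} [IsSFiniteKernel κin]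
    {Ψin : ((↥sV → SU N) × ({c : PBond (F.P K) (j + 1) // c ∉ sV'} → SU N)) × X → ({b : PBond (F.P K) j // b ∉ sV} → SU N)}
    {Jin : ((↥sV → SU N) × ({c : PBond (F.P K) (j + 1) // c ∉ sV'} → SU N)) × X → ℝ≥0}
    {𝒮in : Set ((↥sV → SU N) × (({c : PBond (F.P K) (j + 1) // c ∉ sV'} → SU N) × ({b : PBond (F.P K) j // b ∉ sV} → SU N)))}
    (hΨin : Measurable Ψin) (hJin : Measurable Jin) (h𝒮in : MeasurableSet 𝒮in)
    (hfib : ∀ᵐ u₁ ∂(Measure.pi fun _ : ↥sV => (HaarData.haar : Measure (SU N))),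
      (((Measure.pi fun _ : {c : PBond (F.P K) (j + 1) // c ∉ sV'} => (HaarData.haar : Measure (SU N))) ⊗ₘ
          Kernel.comap κin (Prod.mk u₁) measurable_prodMk_left).withDensity (fun z => (Jin ((u₁, z.1), z.2) : ℝ≥0∞))).map
          (fun z => (z.1, Ψin ((u₁, z.1), z.2))) =
        (jointLaw (Measure.pi fun _ : {b : PBond (F.P K) j // b ∉ sV} => (HaarData.haar : Measure (SU N)))
          (fun u₂ => fun c : {c : PBond (F.P K) (j + 1) // c ∉ sV'} =>
            (avOfRecord F N K j).avg ((MeasurableEquiv.piEquivPiSubtypeProd (fun _ : PBond (F.P K) j => SU N) (· ∈ sV)).symm (u₁, u₂)) c)).restrict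
          (Prod.mk u₁ ⁻¹' 𝒮in)) :
    (((fieldMeasure (F.P K) (j + 1) (SU N)) ⊗ₘ
        (Kernel.comap
          ((Kernel.withDensity
              (condLaw ((Measure.pi fun _ : ↥sV => (HaarData.haar : Measure (SU N))).prod
                (Measure.pi fun _ : {c : PBond (F.P K) (j + 1) // c ∉ sV'} => (HaarData.haar : Measure (SU N))))
                (Prod.map (avgRestrOfRecord F N K j sV sV') id))
              fun v _ => (margDensity ((Measure.pi fun _ : ↥sV => (HaarData.haar : Measure (SU N))).prod
                  (Measure.pi fun _ : {c : PBond (F.P K) (j + 1) // c ∉ sV'} => (HaarData.haar : Measure (SU N))))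
                ((Measure.pi fun _ : ↥sV' => (HaarData.haar : Measure (SU N))).prod
                  (Measure.pi fun _ : {c : PBond (F.P K) (j + 1) // c ∉ sV'} => (HaarData.haar : Measure (SU N))))
                (Prod.map (avgRestrOfRecord F N K j sV sV') id) v : ℝ≥0∞)) ⊗ₖ
            Kernel.prodMkLeft ((↥sV' → SU N) × ({c : PBond (F.P K) (j + 1) // c ∉ sV'} → SU N)) κin)
          (MeasurableEquiv.piEquivPiSubtypeProd (fun _ : PBond (F.P K) (j + 1) => SU N) (· ∈ sV'))
          (MeasurableEquiv.piEquivPiSubtypeProd (fun _ : PBond (F.P K) (j + 1) => SU N) (· ∈ sV')).measurable)).withDensity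
        (fun z => (Jin z.2 : ℝ≥0∞))).map
        (fun z => (z.1, (MeasurableEquiv.piEquivPiSubtypeProd (fun _ : PBond (F.P K) j => SU N) (· ∈ sV)).symm (z.2.1.1, Ψin z.2))) =
      (jointLaw (fieldMeasure (F.P K) j (SU N)) (avOfRecord F N K j).avg).restrict
        {w : GaugeField (F.P K) (j + 1) (SU N) × GaugeField (F.P K) j (SU N) |
          ((MeasurableEquiv.piEquivPiSubtypeProd (fun _ : PBond (F.P K) j => SU N) (· ∈ sV) w.2).1,
            ((fun c : {c : PBond (F.P K) (j + 1) // c ∉ sV'} => (avOfRecord F N K j).avg w.2 c),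
              (MeasurableEquiv.piEquivPiSubtypeProd (fun _ : PBond (F.P K) j => SU N) (· ∈ sV) w.2).2)) ∈ 𝒮in} := by
  -- FILE 5 ★★★ in the glue coordinates of record
  have ha₂ := measurable_avOfRecord_glue_rest F N K j sV sV'
  have h5 := chart_skew_of_fibrewise (ν₂ := Measure.pi fun _ : {b : PBond (F.P K) j // b ∉ sV} => (HaarData.haar : Measure (SU N)))
    (μ₁ := Measure.pi fun _ : ↥sV' => (HaarData.haar : Measure (SU N))) (κin := κin) (Ψin := Ψin) (Jin := Jin) (𝒮in := 𝒮in)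
    (measurable_avgRestrOfRecord (F := F) (N := N) K j sV sV') hac_out ha₂ hΨin hJin h𝒮in hfib
  -- §1 along both glues with n11-e's skew intertwining
  have h1 := chart_of_equiv_presentation
    (MeasurableEquiv.piEquivPiSubtypeProd (fun _ : PBond (F.P K) (j + 1) => SU N) (· ∈ sV')).symm
    (MeasurableEquiv.piEquivPiSubtypeProd (fun _ : PBond (F.P K) j => SU N) (· ∈ sV)).symm
    (avOfRecord_measurable F N K j) ((measurable_avgRestrOfRecord (F := F) (N := N) K j sV sV').comp measurable_fst |>.prodMk ha₂)
    (fun q => avOfRecord_glue_eq_glue F N K j hj hY hsV hsV' q)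
    (show Measurable (fun z : ((↥sV' → SU N) × ({c : PBond (F.P K) (j + 1) // c ∉ sV'} → SU N)) ×
        (((↥sV → SU N) × ({c : PBond (F.P K) (j + 1) // c ∉ sV'} → SU N)) × X) => (z.2.1.1, Ψin z.2)) by fun_prop)
    (hJin.comp measurable_snd) (measurableSet_skewWindow (α₁ := ↥sV' → SU N) ha₂ h𝒮in) h5
  rw [fieldMeasure_eq_map_piEquivPiSubtypeProd_symm (P := F.P K) (G := SU N) sV',
    fieldMeasure_eq_map_piEquivPiSubtypeProd_symm (P := F.P K) (G := SU N) sV]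
  have hwin : {w : GaugeField (F.P K) (j + 1) (SU N) × GaugeField (F.P K) j (SU N) |
      ((MeasurableEquiv.piEquivPiSubtypeProd (fun _ : PBond (F.P K) j => SU N) (· ∈ sV) w.2).1,
        ((fun c : {c : PBond (F.P K) (j + 1) // c ∉ sV'} => (avOfRecord F N K j).avg w.2 c),
          (MeasurableEquiv.piEquivPiSubtypeProd (fun _ : PBond (F.P K) j => SU N) (· ∈ sV) w.2).2)) ∈ 𝒮in} =
      {w : GaugeField (F.P K) (j + 1) (SU N) × GaugeField (F.P K) j (SU N) |
        ((MeasurableEquiv.piEquivPiSubtypeProd (fun _ : PBond (F.P K) (j + 1) => SU N) (· ∈ sV')).symm.symm w.1,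
          (MeasurableEquiv.piEquivPiSubtypeProd (fun _ : PBond (F.P K) j => SU N) (· ∈ sV)).symm.symm w.2) ∈
          {q : ((↥sV' → SU N) × ({c : PBond (F.P K) (j + 1) // c ∉ sV'} → SU N)) ×
              ((↥sV → SU N) × ({b : PBond (F.P K) j // b ∉ sV} → SU N)) |
            (q.2.1, ((fun c : {c : PBond (F.P K) (j + 1) // c ∉ sV'} =>
              (avOfRecord F N K j).avg ((MeasurableEquiv.piEquivPiSubtypeProd (fun _ : PBond (F.P K) j => SU N) (· ∈ sV)).symm q.2) c), q.2.2)) ∈ 𝒮in}} := by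
    ext w
    simp only [Set.mem_setOf_eq, MeasurableEquiv.symm_symm, MeasurableEquiv.symm_apply_apply]
  rw [hwin]
  exact h1

/-- The window of §2 read on the fine carrier of record, `{(V, U) | ((e_β⁻¹U).1, ((c ∉ sV') ↦ Ū c, (e_β⁻¹U).2)) ∈ 𝒮_in}`, is measurable.
[cite: Balaban1988Convergent, (3.2)–(3.5) p.265 (bookkeeping)] -/
theorem measurableSet_glueWindow (K j : ℕ) [DecidableEq (PBond (F.P K) j)] (sV : Finset (PBond (F.P K) j)) (sV' : Finset (PBond (F.P K) (j + 1)))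
    {𝒮in : Set ((↥sV → SU N) × (({c : PBond (F.P K) (j + 1) // c ∉ sV'} → SU N) × ({b : PBond (F.P K) j // b ∉ sV} → SU N)))}
    (h𝒮in : MeasurableSet 𝒮in) :
    MeasurableSet {w : GaugeField (F.P K) (j + 1) (SU N) × GaugeField (F.P K) j (SU N) |
      ((MeasurableEquiv.piEquivPiSubtypeProd (fun _ : PBond (F.P K) j => SU N) (· ∈ sV) w.2).1,
        ((fun c : {c : PBond (F.P K) (j + 1) // c ∉ sV'} => (avOfRecord F N K j).avg w.2 c),
          (MeasurableEquiv.piEquivPiSubtypeProd (fun _ : PBond (F.P K) j => SU N) (· ∈ sV) w.2).2)) ∈ 𝒮in} := by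
  have hE : Measurable fun w : GaugeField (F.P K) (j + 1) (SU N) × GaugeField (F.P K) j (SU N) =>
      MeasurableEquiv.piEquivPiSubtypeProd (fun _ : PBond (F.P K) j => SU N) (· ∈ sV) w.2 :=
    (MeasurableEquiv.measurable _).comp measurable_snd
  refine (Measurable.prodMk (measurable_fst.comp hE) (Measurable.prodMk ?_ (measurable_snd.comp hE))) h𝒮in
  exact measurable_pi_lambda _ fun c => (measurable_pi_apply (c : PBond (F.P K) (j + 1))).comp
    ((avOfRecord_measurable F N K j).comp measurable_snd)

/-- **★★ THE COMPOSITE FIBRE MEASURE AT THE RECORD, UNFOLDED — every integrand at once, outer factor in 11a's currency**: for `dV′`-a.e. `V′` and EVERY real `f` integrable on the fibre,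
the integral against FILE 5's composite kernel at `e_α⁻¹V′ = (o, r)` is `margDensity (Π_{sV} Haar) (Π_{sV'} Haar) (avgRestrOfRecord …) o · ∫ condLaw(…)(o, du₁) ∫ κ_in((u₁,r),dx) f((u₁,r),x)`
(FILE 5 ★★ `ae_forall_integral_compositeKernel_eq` transported along `e_α` by `MeasurableEmbedding.ae_map_iff`). [cite: Balaban1988Convergent, (2.21) p.258, (3.1) p.264, p.270 L3–6 (bookkeeping)] -/
theorem ae_forall_integral_compositeKernel_eq_glue (K j : ℕ) [DecidableEq (PBond (F.P K) j)] [DecidableEq (PBond (F.P K) (j + 1))]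
    (sV : Finset (PBond (F.P K) j)) (sV' : Finset (PBond (F.P K) (j + 1)))
    (hac_out : (Measure.pi fun _ : ↥sV => (HaarData.haar : Measure (SU N))).map (avgRestrOfRecord F N K j sV sV') ≪
      Measure.pi fun _ : ↥sV' => (HaarData.haar : Measure (SU N)))
    {X : Type*} [MeasurableSpace X] (κin : Kernel ((↥sV → SU N) × ({c : PBond (F.P K) (j + 1) // c ∉ sV'} → SU N)) X) [IsSFiniteKernel κin] :
    ∀ᵐ V' ∂(fieldMeasure (F.P K) (j + 1) (SU N)), ∀ f : ((↥sV → SU N) × ({c : PBond (F.P K) (j + 1) // c ∉ sV'} → SU N)) × X → ℝ,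
      Integrable f (((condLaw (Measure.pi fun _ : ↥sV => (HaarData.haar : Measure (SU N))) (avgRestrOfRecord F N K j sV sV')
            (MeasurableEquiv.piEquivPiSubtypeProd (fun _ : PBond (F.P K) (j + 1) => SU N) (· ∈ sV') V').1).map
            (fun u₁ => (u₁, (MeasurableEquiv.piEquivPiSubtypeProd (fun _ : PBond (F.P K) (j + 1) => SU N) (· ∈ sV') V').2))) ⊗ₘ κin) →
      ∫ q, f q ∂(((Kernel.withDensity
              (condLaw ((Measure.pi fun _ : ↥sV => (HaarData.haar : Measure (SU N))).prod
                (Measure.pi fun _ : {c : PBond (F.P K) (j + 1) // c ∉ sV'} => (HaarData.haar : Measure (SU N))))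
                (Prod.map (avgRestrOfRecord F N K j sV sV') id))
              fun v _ => (margDensity ((Measure.pi fun _ : ↥sV => (HaarData.haar : Measure (SU N))).prod
                  (Measure.pi fun _ : {c : PBond (F.P K) (j + 1) // c ∉ sV'} => (HaarData.haar : Measure (SU N))))
                ((Measure.pi fun _ : ↥sV' => (HaarData.haar : Measure (SU N))).prod
                  (Measure.pi fun _ : {c : PBond (F.P K) (j + 1) // c ∉ sV'} => (HaarData.haar : Measure (SU N))))
                (Prod.map (avgRestrOfRecord F N K j sV sV') id) v : ℝ≥0∞)) ⊗ₖ
            Kernel.prodMkLeft ((↥sV' → SU N) × ({c : PBond (F.P K) (j + 1) // c ∉ sV'} → SU N)) κin)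
          (MeasurableEquiv.piEquivPiSubtypeProd (fun _ : PBond (F.P K) (j + 1) => SU N) (· ∈ sV') V')) =
        (margDensity (Measure.pi fun _ : ↥sV => (HaarData.haar : Measure (SU N))) (Measure.pi fun _ : ↥sV' => (HaarData.haar : Measure (SU N)))
            (avgRestrOfRecord F N K j sV sV') (MeasurableEquiv.piEquivPiSubtypeProd (fun _ : PBond (F.P K) (j + 1) => SU N) (· ∈ sV') V').1 : ℝ) *
          ∫ u₁, ∫ x, f ((u₁, (MeasurableEquiv.piEquivPiSubtypeProd (fun _ : PBond (F.P K) (j + 1) => SU N) (· ∈ sV') V').2), x)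
            ∂(κin (u₁, (MeasurableEquiv.piEquivPiSubtypeProd (fun _ : PBond (F.P K) (j + 1) => SU N) (· ∈ sV') V').2))
            ∂(condLaw (Measure.pi fun _ : ↥sV => (HaarData.haar : Measure (SU N))) (avgRestrOfRecord F N K j sV sV')
              (MeasurableEquiv.piEquivPiSubtypeProd (fun _ : PBond (F.P K) (j + 1) => SU N) (· ∈ sV') V').1) := by
  have h0 := ae_forall_integral_compositeKernel_eq (ν₁ := Measure.pi fun _ : ↥sV => (HaarData.haar : Measure (SU N)))
    (μ₂ := Measure.pi fun _ : {c : PBond (F.P K) (j + 1) // c ∉ sV'} => (HaarData.haar : Measure (SU N))) (κin := κin)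
    (measurable_avgRestrOfRecord (F := F) (N := N) K j sV sV') hac_out
  rw [fieldMeasure_eq_map_piEquivPiSubtypeProd_symm (P := F.P K) (G := SU N) sV']
  refine ((MeasurableEquiv.measurableEmbedding
    (MeasurableEquiv.piEquivPiSubtypeProd (fun _ : PBond (F.P K) (j + 1) => SU N) (· ∈ sV')).symm).ae_map_iff).2 ?_
  filter_upwards [h0] with v hv
  simpa only [MeasurableEquiv.apply_symm_apply] using hv

/-- **★★★ THE SEPARATED ONE-STEP TRANSPORT OF RECORD, EVERY DENSITY AT ONCE, OUTER FACTOR = 11a's `kernelRTOfRecord`**: under the data of §2 and `j < K`, for `dV′`-a.e. `V′`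
and EVERY measurable `ρ` vanishing off the window with integrable inside reading, `transportOfRecord F N K j ρ V′ = kernelRTOfRecord F N K j sV sV' (u₁ ↦ ∫ κ_in((u₁,r),dx) J_in ·
ρ(e_β(u₁, Ψ_in((u₁,r),x)))) o`, `(o, r) := e_α⁻¹ V′` — print's `∫dU δ(ŪV′⁻¹) ρ(U)` ([I] (0.4), [III] (3.1)) SEPARATED as in [III] §3 p.267: outside variables by 11a's TRUE restricted
transport (n11-e's `kernelTransport_avgRestrOfRecord_eq_kernelRTOfRecord`, `rfl`), inside variables charted fibrewise; null set UNIFORM IN `ρ`.  FILE 1 ★★★ at §2 + ★★ above.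
Companions (per-density): dag-n11-w2's p614048, dag-n11-d's p616225. [cite: Balaban1987RG1, (0.4) p.253; Balaban1988Convergent, (2.21) p.258, (3.1) p.264, (3.2)–(3.5) p.265, (3.10)–(3.11) p.266, p.267 L18–24] -/
theorem ae_forall_transportOfRecord_eq_kernelRTOfRecord_glue (K j : ℕ) [DecidableEq (PBond (F.P K) j)] [DecidableEq (PBond (F.P K) (j + 1))]
    (hk : j < K) (hj : j + 1 ≤ (F.P K).m + (F.P K).K)
    {Y : Set (Site (F.P K) 0)} (hY : ∀ s : Site (F.P K) j, toFine j s ∈ Y ↔ toFine (j + 1) (blockOf s) ∈ Y)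
    {sV : Finset (PBond (F.P K) j)} (hsV : ∀ b : PBond (F.P K) j, b ∈ bondsIn j Y → b ∈ sV)
    {sV' : Finset (PBond (F.P K) (j + 1))} (hsV' : ∀ c : PBond (F.P K) (j + 1), c ∈ sV' → c ∈ bondsIn (j + 1) Y)
    (hac_out : (Measure.pi fun _ : ↥sV => (HaarData.haar : Measure (SU N))).map (avgRestrOfRecord F N K j sV sV') ≪
      Measure.pi fun _ : ↥sV' => (HaarData.haar : Measure (SU N)))
    {X : Type*} [MeasurableSpace X]
    {κin : Kernel ((↥sV → SU N) × ({c : PBond (F.P K) (j + 1) // c ∉ sV'} → SU N)) X} [IsSFiniteKernel κin]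
    {Ψin : ((↥sV → SU N) × ({c : PBond (F.P K) (j + 1) // c ∉ sV'} → SU N)) × X → ({b : PBond (F.P K) j // b ∉ sV} → SU N)}
    {Jin : ((↥sV → SU N) × ({c : PBond (F.P K) (j + 1) // c ∉ sV'} → SU N)) × X → ℝ≥0}
    {𝒮in : Set ((↥sV → SU N) × (({c : PBond (F.P K) (j + 1) // c ∉ sV'} → SU N) × ({b : PBond (F.P K) j // b ∉ sV} → SU N)))}
    (hΨin : Measurable Ψin) (hJin : Measurable Jin) (h𝒮in : MeasurableSet 𝒮in)
    (hfib : ∀ᵐ u₁ ∂(Measure.pi fun _ : ↥sV => (HaarData.haar : Measure (SU N))),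
      (((Measure.pi fun _ : {c : PBond (F.P K) (j + 1) // c ∉ sV'} => (HaarData.haar : Measure (SU N))) ⊗ₘ
          Kernel.comap κin (Prod.mk u₁) measurable_prodMk_left).withDensity (fun z => (Jin ((u₁, z.1), z.2) : ℝ≥0∞))).map
          (fun z => (z.1, Ψin ((u₁, z.1), z.2))) =
        (jointLaw (Measure.pi fun _ : {b : PBond (F.P K) j // b ∉ sV} => (HaarData.haar : Measure (SU N)))
          (fun u₂ => fun c : {c : PBond (F.P K) (j + 1) // c ∉ sV'} =>
            (avOfRecord F N K j).avg ((MeasurableEquiv.piEquivPiSubtypeProd (fun _ : PBond (F.P K) j => SU N) (· ∈ sV)).symm (u₁, u₂)) c)).restrict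
          (Prod.mk u₁ ⁻¹' 𝒮in)) :
    ∀ᵐ V' ∂(fieldMeasure (F.P K) (j + 1) (SU N)), ∀ ρ : Density (F.P K) j (SU N), Measurable ρ →
      (∀ U : GaugeField (F.P K) j (SU N),
        ((MeasurableEquiv.piEquivPiSubtypeProd (fun _ : PBond (F.P K) j => SU N) (· ∈ sV) U).1,
          ((fun c : {c : PBond (F.P K) (j + 1) // c ∉ sV'} => (avOfRecord F N K j).avg U c),
            (MeasurableEquiv.piEquivPiSubtypeProd (fun _ : PBond (F.P K) j => SU N) (· ∈ sV) U).2)) ∉ 𝒮in → ρ U = 0) →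
      Integrable (fun q : ((↥sV → SU N) × ({c : PBond (F.P K) (j + 1) // c ∉ sV'} → SU N)) × X =>
          (Jin q : ℝ) * ρ ((MeasurableEquiv.piEquivPiSubtypeProd (fun _ : PBond (F.P K) j => SU N) (· ∈ sV)).symm (q.1.1, Ψin q)))
        (((condLaw (Measure.pi fun _ : ↥sV => (HaarData.haar : Measure (SU N))) (avgRestrOfRecord F N K j sV sV')
            (MeasurableEquiv.piEquivPiSubtypeProd (fun _ : PBond (F.P K) (j + 1) => SU N) (· ∈ sV') V').1).map
            (fun u₁ => (u₁, (MeasurableEquiv.piEquivPiSubtypeProd (fun _ : PBond (F.P K) (j + 1) => SU N) (· ∈ sV') V').2))) ⊗ₘ κin) →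
      transportOfRecord F N K j ρ V' =
        kernelRTOfRecord F N K j sV sV'
          (fun u₁ => ∫ x, (Jin ((u₁, (MeasurableEquiv.piEquivPiSubtypeProd (fun _ : PBond (F.P K) (j + 1) => SU N) (· ∈ sV') V').2), x) : ℝ) *
            ρ ((MeasurableEquiv.piEquivPiSubtypeProd (fun _ : PBond (F.P K) j => SU N) (· ∈ sV)).symm
              (u₁, Ψin ((u₁, (MeasurableEquiv.piEquivPiSubtypeProd (fun _ : PBond (F.P K) (j + 1) => SU N) (· ∈ sV') V').2), x)))
            ∂(κin (u₁, (MeasurableEquiv.piEquivPiSubtypeProd (fun _ : PBond (F.P K) (j + 1) => SU N) (· ∈ sV') V').2)))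
          (MeasurableEquiv.piEquivPiSubtypeProd (fun _ : PBond (F.P K) (j + 1) => SU N) (· ∈ sV') V').1 := by
  have hchart := chart_avOfRecord_of_fibrewise_glue (F := F) (N := N) K j hj hY hsV hsV' hac_out hΨin hJin h𝒮in hfib
  -- FILE 1 ★★★ at the record chart: every density at once; FILE 5 ★★ transported: the fibre measure unfolded
  have hT := ae_forall_kernelTransport_eq_chart (avOfRecord_measurable F N K j) (avOfRecord_haarAC F N K j hk)
    (show Measurable (fun z : GaugeField (F.P K) (j + 1) (SU N) × (((↥sV → SU N) × ({c : PBond (F.P K) (j + 1) // c ∉ sV'} → SU N)) × X) =>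
      (MeasurableEquiv.piEquivPiSubtypeProd (fun _ : PBond (F.P K) j => SU N) (· ∈ sV)).symm (z.2.1.1, Ψin z.2)) from
      (MeasurableEquiv.measurable _).comp (((measurable_fst.comp measurable_fst).comp measurable_snd).prodMk (hΨin.comp measurable_snd)))
    (show Measurable (fun z : GaugeField (F.P K) (j + 1) (SU N) × (((↥sV → SU N) × ({c : PBond (F.P K) (j + 1) // c ∉ sV'} → SU N)) × X) =>
      Jin z.2) from hJin.comp measurable_snd) (measurableSet_glueWindow (F := F) (N := N) K j sV sV' h𝒮in) hchart
  have hI := ae_forall_integral_compositeKernel_eq_glue (F := F) (N := N) K j sV sV' hac_out κin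
  filter_upwards [hT, hI] with V' hV' hI' ρ hρ hρS hint
  rw [show transportOfRecord F N K j ρ V' =
      kernelTransport (fieldMeasure (F.P K) j (SU N)) (fieldMeasure (F.P K) (j + 1) (SU N)) (avOfRecord F N K j).avg ρ V' from rfl,
    hV' ρ hρ (fun U hU => hρS U hU), Kernel.comap_apply, hI' _ hint]
  rfl

end Record

/-! ## §4  def-T's (†) `tstepOfRecord` FOR ALL NEW SEQUENCES AT ONCE at the record, SEPARATED: outer factor = 11a's `kernelRTOfRecord`, inside variables charted fibrewise -/

section TStep

open Node00 hiding SU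
open T4Continuum
open B10Eq42TorusConstraint (bondsIn)
open B10Eq38TorusDomains (toFine)
open BalabanUVNodesN11CondLawInFibreChartSkewAssembly BalabanUVNodesN11TStepInFibreChart

variable {F : T4Family} {N : ℕ} [NeZero N]

/-- **★★★ def-T's VALUE-LEVEL T-STEP (†) AT THE RECORD, FOR ALL NEW SEQUENCES AT ONCE, SEPARATED**: under the data of §2 at `K = p.K`, `k < p.K`, step weights with
measurable `U`-sections and the SUPPORT CLAUSE «`w_k(s′)(U, V′) ≠ 0 ⇒ U` in the window» ((3.2)–(3.5), DISPLAYED), measurable `χ_k(s)` and `T(s)`: for `dV′`-a.e. `V′` and EVERY `s′`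
with integrable separated reading, `(𝐓e^A)_{k+1}(s′)(V′) = kernelRTOfRecord F N K k sV sV' (u₁ ↦ ∫ κ_in((u₁,r),dx) J_in · (w(s′)(·,V′)·χ_k(init s′)·T(init s′))(e_β(u₁, Ψ_in((u₁,r),x)))) o`
— [III] (2.21)∕(3.1): `𝐓^{(k)}` (11a's restricted transport) of the INSIDE chart integral of p.267; the LEFT side of N11's (O3′) in dag-n11-d's `…TStepGenOpJunction` currency, null set
UNIFORM in `s′`.  FILE 2 ★★ `ae_forall_tstepOfRecord_eq_chart` at §2 + ★★ above. [cite: Balaban1988Convergent, (2.21) p.258, (3.1) p.264, (3.2)–(3.5) p.265, p.267 L18–24, (3.24)–(3.25) p.270] -/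
theorem ae_forall_tstepOfRecord_eq_kernelRTOfRecord_glue (p : B12.RunParams) {k : ℕ} [DecidableEq (PBond (F.P p.K) k)] [DecidableEq (PBond (F.P p.K) (k + 1))]
    (ν : Stage7Numerics) (M : ℕ) (w : StepWeightsOfRecord F N ν M) (g : ℕ → ℝ) (hk : k < p.K) (T' : SeqOfRecord F ν M g p.K k → Density (F.P p.K) k (SU N))
    (hj : k + 1 ≤ (F.P p.K).m + (F.P p.K).K)
    {Y : Set (Site (F.P p.K) 0)} (hY : ∀ s : Site (F.P p.K) k, toFine k s ∈ Y ↔ toFine (k + 1) (blockOf s) ∈ Y)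
    {sV : Finset (PBond (F.P p.K) k)} (hsV : ∀ b : PBond (F.P p.K) k, b ∈ bondsIn k Y → b ∈ sV)
    {sV' : Finset (PBond (F.P p.K) (k + 1))} (hsV' : ∀ c : PBond (F.P p.K) (k + 1), c ∈ sV' → c ∈ bondsIn (k + 1) Y)
    (hac_out : (Measure.pi fun _ : ↥sV => (HaarData.haar : Measure (SU N))).map (avgRestrOfRecord F N p.K k sV sV') ≪
      Measure.pi fun _ : ↥sV' => (HaarData.haar : Measure (SU N)))
    {X : Type*} [MeasurableSpace X]
    {κin : Kernel ((↥sV → SU N) × ({c : PBond (F.P p.K) (k + 1) // c ∉ sV'} → SU N)) X} [IsSFiniteKernel κin]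
    {Ψin : ((↥sV → SU N) × ({c : PBond (F.P p.K) (k + 1) // c ∉ sV'} → SU N)) × X → ({b : PBond (F.P p.K) k // b ∉ sV} → SU N)}
    {Jin : ((↥sV → SU N) × ({c : PBond (F.P p.K) (k + 1) // c ∉ sV'} → SU N)) × X → ℝ≥0}
    {𝒮in : Set ((↥sV → SU N) × (({c : PBond (F.P p.K) (k + 1) // c ∉ sV'} → SU N) × ({b : PBond (F.P p.K) k // b ∉ sV} → SU N)))}
    (hΨin : Measurable Ψin) (hJin : Measurable Jin) (h𝒮in : MeasurableSet 𝒮in)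
    (hfib : ∀ᵐ u₁ ∂(Measure.pi fun _ : ↥sV => (HaarData.haar : Measure (SU N))),
      (((Measure.pi fun _ : {c : PBond (F.P p.K) (k + 1) // c ∉ sV'} => (HaarData.haar : Measure (SU N))) ⊗ₘ
          Kernel.comap κin (Prod.mk u₁) measurable_prodMk_left).withDensity (fun z => (Jin ((u₁, z.1), z.2) : ℝ≥0∞))).map
          (fun z => (z.1, Ψin ((u₁, z.1), z.2))) =
        (jointLaw (Measure.pi fun _ : {b : PBond (F.P p.K) k // b ∉ sV} => (HaarData.haar : Measure (SU N)))
          (fun u₂ => fun c : {c : PBond (F.P p.K) (k + 1) // c ∉ sV'} =>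
            (avOfRecord F N p.K k).avg ((MeasurableEquiv.piEquivPiSubtypeProd (fun _ : PBond (F.P p.K) k => SU N) (· ∈ sV)).symm (u₁, u₂)) c)).restrict
          (Prod.mk u₁ ⁻¹' 𝒮in))
    (hw : ∀ s' V', Measurable fun U => w p g k s' U V') (hχ : ∀ s, Measurable (chiSeqOfRecord F N ν M g p.K k s))
    (hT : ∀ s, Measurable (T' s))
    (hwS : ∀ s' (U : GaugeField (F.P p.K) k (SU N)) V',
      ((MeasurableEquiv.piEquivPiSubtypeProd (fun _ : PBond (F.P p.K) k => SU N) (· ∈ sV) U).1,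
        ((fun c : {c : PBond (F.P p.K) (k + 1) // c ∉ sV'} => (avOfRecord F N p.K k).avg U c),
          (MeasurableEquiv.piEquivPiSubtypeProd (fun _ : PBond (F.P p.K) k => SU N) (· ∈ sV) U).2)) ∉ 𝒮in → w p g k s' U V' = 0) :
    ∀ᵐ V' ∂(fieldMeasure (F.P p.K) (k + 1) (SU N)), ∀ s' : SeqOfRecord F ν M g p.K (k + 1),
      Integrable (fun q : ((↥sV → SU N) × ({c : PBond (F.P p.K) (k + 1) // c ∉ sV'} → SU N)) × X =>
          (Jin q : ℝ) * (w p g k s' ((MeasurableEquiv.piEquivPiSubtypeProd (fun _ : PBond (F.P p.K) k => SU N) (· ∈ sV)).symm (q.1.1, Ψin q)) V' *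
            (chiSeqOfRecord F N ν M g p.K k s'.init ((MeasurableEquiv.piEquivPiSubtypeProd (fun _ : PBond (F.P p.K) k => SU N) (· ∈ sV)).symm (q.1.1, Ψin q)) *
              T' s'.init ((MeasurableEquiv.piEquivPiSubtypeProd (fun _ : PBond (F.P p.K) k => SU N) (· ∈ sV)).symm (q.1.1, Ψin q)))))
        (((condLaw (Measure.pi fun _ : ↥sV => (HaarData.haar : Measure (SU N))) (avgRestrOfRecord F N p.K k sV sV')
            (MeasurableEquiv.piEquivPiSubtypeProd (fun _ : PBond (F.P p.K) (k + 1) => SU N) (· ∈ sV') V').1).map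
            (fun u₁ => (u₁, (MeasurableEquiv.piEquivPiSubtypeProd (fun _ : PBond (F.P p.K) (k + 1) => SU N) (· ∈ sV') V').2))) ⊗ₘ κin) →
      tstepOfRecord F N ν M w p g k T' s' V' =
        kernelRTOfRecord F N p.K k sV sV'
          (fun u₁ => ∫ x, (Jin ((u₁, (MeasurableEquiv.piEquivPiSubtypeProd (fun _ : PBond (F.P p.K) (k + 1) => SU N) (· ∈ sV') V').2), x) : ℝ) *
            (w p g k s' ((MeasurableEquiv.piEquivPiSubtypeProd (fun _ : PBond (F.P p.K) k => SU N) (· ∈ sV)).symm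
                (u₁, Ψin ((u₁, (MeasurableEquiv.piEquivPiSubtypeProd (fun _ : PBond (F.P p.K) (k + 1) => SU N) (· ∈ sV') V').2), x))) V' *
              (chiSeqOfRecord F N ν M g p.K k s'.init ((MeasurableEquiv.piEquivPiSubtypeProd (fun _ : PBond (F.P p.K) k => SU N) (· ∈ sV)).symm
                  (u₁, Ψin ((u₁, (MeasurableEquiv.piEquivPiSubtypeProd (fun _ : PBond (F.P p.K) (k + 1) => SU N) (· ∈ sV') V').2), x))) *
                T' s'.init ((MeasurableEquiv.piEquivPiSubtypeProd (fun _ : PBond (F.P p.K) k => SU N) (· ∈ sV)).symm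
                  (u₁, Ψin ((u₁, (MeasurableEquiv.piEquivPiSubtypeProd (fun _ : PBond (F.P p.K) (k + 1) => SU N) (· ∈ sV') V').2), x)))))
            ∂(κin (u₁, (MeasurableEquiv.piEquivPiSubtypeProd (fun _ : PBond (F.P p.K) (k + 1) => SU N) (· ∈ sV') V').2)))
          (MeasurableEquiv.piEquivPiSubtypeProd (fun _ : PBond (F.P p.K) (k + 1) => SU N) (· ∈ sV') V').1 := by
  have hchart := chart_avOfRecord_of_fibrewise_glue (F := F) (N := N) p.K k hj hY hsV hsV' hac_out hΨin hJin h𝒮in hfib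
  -- FILE 2 ★★ (†) at the record chart, all s′ at once; FILE 5 ★★ transported: the fibre measure unfolded
  have hT' := ae_forall_tstepOfRecord_eq_chart ν M w p g hk T'
    (show Measurable (fun z : GaugeField (F.P p.K) (k + 1) (SU N) × (((↥sV → SU N) × ({c : PBond (F.P p.K) (k + 1) // c ∉ sV'} → SU N)) × X) =>
      (MeasurableEquiv.piEquivPiSubtypeProd (fun _ : PBond (F.P p.K) k => SU N) (· ∈ sV)).symm (z.2.1.1, Ψin z.2)) from
      (MeasurableEquiv.measurable _).comp (((measurable_fst.comp measurable_fst).comp measurable_snd).prodMk (hΨin.comp measurable_snd)))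
    (show Measurable (fun z : GaugeField (F.P p.K) (k + 1) (SU N) × (((↥sV → SU N) × ({c : PBond (F.P p.K) (k + 1) // c ∉ sV'} → SU N)) × X) =>
      Jin z.2) from hJin.comp measurable_snd) (measurableSet_glueWindow (F := F) (N := N) p.K k sV sV' h𝒮in) hchart hw hχ hT
    (fun s' U V' hU => hwS s' U V' hU)
  have hI := ae_forall_integral_compositeKernel_eq_glue (F := F) (N := N) p.K k sV sV' hac_out κin
  filter_upwards [hT', hI] with V' hV' hI' s' hint
  rw [hV' s', Kernel.comap_apply, hI' _ hint]
  rfl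

end TStep

end Summit.QuantumFields.YangMills.Theorems.BalabanUVNodesN11CondLawInFibreChartAtRecord

end
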